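import Literature.Geometry.Riemannian.LinearHeatBorel
import Literature.Geometry.Lorentzian.GreenIdentityCompactSupport
import HarnessLib

/-!
# The flat corrector for compactly supported data on a non-compact manifold (crux
# `EntropyRung.NoncompactShrinkerGap`, stmt-SmoothPoincare4-10868, line `collapsed-ends-usc`, skeleton v13)

Registered helper `helper_flatCorrector_noncompact` of the stub `stub_compactSupportLSI`: the non-compact
version of `exists_flat_corrector` (`LinearHeatBorel.lean`, closed manifolds) for COMPACTLY SUPPORTED data.
For a Riemannian metric `g` on a manifold `M` modelled on `ℝⁿ` (Hausdorff, second countable — NOT compact),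
a potential `Q` smooth on `M × ℝ` and a smooth compactly supported datum `w₀` there are `W`, `G` smooth on
`M × ℝ` and a compact `K ⊆ M` with `W(0) = w₀`, `W` and `G` vanishing off `K` and for `s ≥ 1`, `G = 0`
for `s ≤ 0`, and `G = −(∂ₛW − Δ_g W + QW)` for `s ≥ 0`.

Proof: Borel summation of the formal power series solution exactly as in the closed case — the jets
`a_k = heatJet` of the formal solution are supported in `tsupport w₀` (differential operators do not
enlarge supports), so Borel's lemma in time is only needed on the compact `tsupport w₀`: a finite cover
by chart domains inside a relatively compact neighbourhood, a smooth partition of unity on `tsupport w₀`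
subordinate to it (compactly supported bumps), the cut-off series `exists_borel_extension` on the model
space chart by chart (`exists_contMDiff_forall_iteratedDeriv_eq_of_isCompact`); the residual is flat
(`iteratedDeriv_residual_eq_zero`) and is glued with zero across `s = 0` (`contMDiff_timeCutoff_manifold`);
a time cut-off `θ(s)` (`θ = 1` near `(−∞, 0]`, `θ = 0` on `[1, ∞)`) makes everything vanish for `s ≥ 1`
without changing the jets at `s = 0`.

References: L. Hörmander, *ALPDO I*, Thm. 1.2.6 (Borel); F. Trèves, *Basic Linear Partial Differential
Equations* (1975), §41.
-/

noncomputable section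

set_option linter.dupNamespace false

open Set Function Filter Manifold Bundle
open scoped Manifold ContDiff Topology

namespace Summit.SmoothPoincare4.SmoothPoincare4.Theorems.NoncompactShrinkerGapHeat

open Literature.Geometry.Riemannian Literature.Geometry.Lorentzian
open Literature.Geometry.Lorentzian.PseudoRiemannianMetric Literature.Analysis.Calculus

/-! ### Borel's lemma in time on a compact subset of a manifold -/

section ManifoldBorel

variable {E : Type*} [NormedAddCommGroup E] [NormedSpace ℝ E] [FiniteDimensional ℝ E]
  {H : Type*} [TopologicalSpace H] {I : ModelWithCorners ℝ E H} [I.Boundaryless]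
  {M : Type*} [TopologicalSpace M] [ChartedSpace H M] [IsManifold I ∞ M] [T2Space M]

omit [FiniteDimensional ℝ E] [T2Space M] in
/-- **Chart transfer of Borel data with compact support**: for a smooth `ρ` with COMPACT support inside the
chart domain of `x₀` and smooth `a_k`, the functions `bₖ = 1_{Φ.target} · (ρ a_k) ∘ Φ⁻¹` (`Φ = extChartAt I x₀`)
are smooth on the model space and vanish off the compact set `Φ(tsupport ρ)` (copy of `exists_chart_borelData`
with the compactness of `tsupport ρ` as a hypothesis instead of `CompactSpace M`). [folklore] -/
theorem exists_chart_borelData_cs (x₀ : M) {ρ : M → ℝ} (hρ : ContMDiff I 𝓘(ℝ, ℝ) ∞ ρ)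
    (hρK : IsCompact (tsupport ρ)) (hρs : tsupport ρ ⊆ (chartAt H x₀).source) {a : ℕ → M → ℝ}
    (ha : ∀ k, ContMDiff I 𝓘(ℝ, ℝ) ∞ (a k)) :
    ∃ b : ℕ → E → ℝ, (∀ k, ContDiff ℝ ∞ (b k)) ∧ (∀ k, HasCompactSupport (b k)) ∧
      (∀ k, ∀ x ∈ (chartAt H x₀).source, b k (extChartAt I x₀ x) = ρ x * a k x) ∧
      (∀ k y, y ∉ extChartAt I x₀ '' tsupport ρ → b k y = 0) := by
  set Φ := extChartAt I x₀ with hΦ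
  have hsrc : (chartAt H x₀).source = Φ.source := by rw [hΦ, extChartAt_source]
  have hVt : IsOpen Φ.target := isOpen_extChartAt_target x₀
  -- the compact set
  set K : Set E := Φ '' tsupport ρ with hK
  have hKc : IsCompact K := by
    refine hρK.image_of_continuousOn ?_
    exact (continuousOn_extChartAt x₀).mono (by rwa [← hsrc])
  have hKt : K ⊆ Φ.target := by
    rintro _ ⟨x, hx, rfl⟩
    exact Φ.map_source (by rw [← hsrc]; exact hρs hx)
  -- the functions
  set b : ℕ → E → ℝ := fun k ↦ Φ.target.indicator fun y ↦ ρ (Φ.symm y) * a k (Φ.symm y) with hb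
  have hb_in : ∀ k, ∀ y ∈ Φ.target, b k y = ρ (Φ.symm y) * a k (Φ.symm y) :=
    fun k y hy ↦ by simp [hb, indicator_of_mem hy]
  have hb_out : ∀ k y, y ∉ K → b k y = 0 := by
    intro k y hy
    by_cases hyt : y ∈ Φ.target
    · rw [hb_in k y hyt]
      have : Φ.symm y ∉ tsupport ρ := by
        intro h'
        exact hy ⟨Φ.symm y, h', Φ.right_inv hyt⟩
      rw [image_eq_zero_of_notMem_tsupport this, zero_mul]
    · simp [hb, indicator_of_notMem hyt]
  have hb_chart : ∀ k, ∀ x ∈ (chartAt H x₀).source, b k (Φ x) = ρ x * a k x := by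
    intro k x hx
    rw [hsrc] at hx
    rw [hb_in k (Φ x) (Φ.map_source hx), Φ.left_inv hx]
  -- smoothness
  have hb_on : ∀ k, ContDiffOn ℝ ∞ (b k) Φ.target := by
    intro k
    have h1 : ContMDiffOn 𝓘(ℝ, E) 𝓘(ℝ, ℝ) ∞ (fun y ↦ ρ (Φ.symm y) * a k (Φ.symm y)) Φ.target :=
      ((hρ.mul (ha k)).comp_contMDiffOn (contMDiffOn_extChartAt_symm x₀))
    exact (contMDiffOn_iff_contDiffOn.1 h1).congr fun y hy ↦ hb_in k y hy
  have hbs : ∀ k, ContDiff ℝ ∞ (b k) := by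
    intro k
    rw [contDiff_iff_contDiffAt]
    intro y
    by_cases hy : y ∈ Φ.target
    · exact (hb_on k).contDiffAt (hVt.mem_nhds hy)
    · have hyK : y ∉ K := fun h ↦ hy (hKt h)
      have hev : b k =ᶠ[𝓝 y] fun _ ↦ 0 := by
        filter_upwards [hKc.isClosed.isOpen_compl.mem_nhds hyK] with z hz using hb_out k z hz
      exact (contDiffAt_const (c := (0 : ℝ))).congr_of_eventuallyEq hev
  have hbK : ∀ k, HasCompactSupport (b k) :=
    fun k ↦ HasCompactSupport.intro hKc fun y hy ↦ hb_out k y hy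
  exact ⟨b, hbs, hbK, hb_chart, hb_out⟩

variable [LocallyCompactSpace M] [SigmaCompactSpace M]

/-- **Borel's lemma in the time variable on a compact subset of a manifold**: for smooth `a_k : M → ℝ` all
vanishing off a compact `K` there is `W : ℝ → M → ℝ`, smooth on `M × ℝ`, with
`(d/ds)^k W(·, x)|_{s=0} = a_k(x)` for all `k, x`, and vanishing off a compact set. Proof: a finite cover of `K`
by chart domains inside a relatively compact open neighbourhood of `K`, a smooth partition of unity on `K`
subordinate to it, and Borel's lemma with parameters on the model space (`exists_borel_extension`), as in
`exists_contMDiff_forall_iteratedDeriv_eq_manifold`. [folklore] -/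
theorem exists_contMDiff_forall_iteratedDeriv_eq_of_isCompact {K : Set M} (hK : IsCompact K)
    {a : ℕ → M → ℝ} (ha : ∀ k, ContMDiff I 𝓘(ℝ, ℝ) ∞ (a k)) (haK : ∀ k x, x ∉ K → a k x = 0) :
    ∃ (W : ℝ → M → ℝ) (K' : Set M), IsCompact K' ∧
      ContMDiff (I.prod 𝓘(ℝ, ℝ)) 𝓘(ℝ, ℝ) ∞ (fun p : M × ℝ ↦ W p.2 p.1) ∧
      (∀ (k : ℕ) (x : M), iteratedDeriv k (fun s ↦ W s x) 0 = a k x) ∧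
      ∀ s x, x ∉ K' → W s x = 0 := by
  classical
  -- a relatively compact open neighbourhood `V` of `K`, a finite chart cover of `K` inside `V`
  obtain ⟨K₀, hK₀c, hKK₀⟩ := exists_compact_superset hK
  set V : Set M := interior K₀ with hVdef
  have hVo : IsOpen V := isOpen_interior
  have hKV : K ⊆ V := hKK₀
  have hVc : IsCompact (closure V) :=
    hK₀c.of_isClosed_subset isClosed_closure (closure_minimal interior_subset hK₀c.isClosed)
  obtain ⟨t, ht⟩ := hK.elim_finite_subcover (fun x : M ↦ (chartAt H x).source ∩ V)
    (fun x ↦ (chartAt H x).open_source.inter hVo)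
    (fun x hx ↦ mem_iUnion.2 ⟨x, mem_chart_source H x, hKV hx⟩)
  set U : ↥t → Set M := fun i ↦ (chartAt H (i : M)).source ∩ V with hU
  have hUo : ∀ i, IsOpen (U i) := fun i ↦ (chartAt H (i : M)).open_source.inter hVo
  have hUc : K ⊆ ⋃ i, U i := by
    intro x hx
    obtain ⟨i, hi, hx'⟩ := mem_iUnion₂.1 (ht hx)
    exact mem_iUnion.2 ⟨⟨i, hi⟩, hx'⟩
  obtain ⟨ρ, hρU⟩ := SmoothPartitionOfUnity.exists_isSubordinate I hK.isClosed U hUo hUc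
  have hρsrc : ∀ i, tsupport (ρ i) ⊆ (chartAt H (i : M)).source := fun i ↦
    (hρU i).trans inter_subset_left
  have hρcpt : ∀ i, IsCompact (tsupport (ρ i)) := fun i ↦
    hVc.of_isClosed_subset (isClosed_tsupport _) (((hρU i).trans inter_subset_right).trans subset_closure)
  -- chart-wise Borel data and Borel functions
  have hdata := fun i : ↥t ↦ exists_chart_borelData_cs (I := I) (i : M) (ρ i).contMDiff (hρcpt i)
    (hρsrc i) ha
  choose b hbs hbK hbchart hbout using hdata
  have hW := fun i : ↥t ↦ exists_borel_extension (b i) (hbs i) (hbK i) (fun _ ↦ 1) fun _ ↦ one_pos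
  choose ε hε hWcs hWcjet using hW
  set Wc : ↥t → E × ℝ → ℝ := fun i z ↦ ∑' k, cutoffMonomial k (ε i k) z.2 * b i k z.1 with hWc
  have hWczero : ∀ i y, (∀ k, b i k y = 0) → ∀ s, Wc i (y, s) = 0 := by
    intro i y hy s; simp [hWc, hy]
  -- transplant to `M`
  set Wt : ↥t → ℝ → M → ℝ := fun i s x ↦
    if x ∈ (chartAt H (i : M)).source then Wc i (extChartAt I (i : M) x, s) else 0 with hWt
  have hWt_zero' : ∀ i, ∀ x ∉ tsupport (ρ i), ∀ s, Wt i s x = 0 := by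
    intro i x' hx' s
    simp only [hWt]
    split_ifs with hsrc
    · apply hWczero i
      intro k
      apply hbout i k
      rintro ⟨x'', hx'', heq⟩
      have h1 : x'' ∈ (extChartAt I (i : M)).source := by
        rw [extChartAt_source]; exact hρsrc i hx''
      have h2 : x' ∈ (extChartAt I (i : M)).source := by rwa [extChartAt_source]
      have : x'' = x' := (extChartAt I (i : M)).injOn h1 h2 heq
      exact hx' (this ▸ hx'')
    · rfl
  have hWt_zero : ∀ i, ∀ x ∉ tsupport (ρ i), ∃ N ∈ 𝓝 x, ∀ x' ∈ N, ∀ s, Wt i s x' = 0 := by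
    intro i x hx
    exact ⟨(tsupport (ρ i))ᶜ, (isClosed_tsupport _).isOpen_compl.mem_nhds hx,
      fun x' hx' s ↦ hWt_zero' i x' hx' s⟩
  have hWt_smooth : ∀ i, ContMDiff (I.prod 𝓘(ℝ, ℝ)) 𝓘(ℝ, ℝ) ∞ (fun p : M × ℝ ↦ Wt i p.2 p.1) := by
    intro i
    rintro ⟨x, s⟩
    by_cases hx : x ∈ (chartAt H (i : M)).source
    · -- composition with the product chart on the chart domain
      have hsrc : x ∈ (extChartAt I (i : M)).source := by rwa [extChartAt_source]
      have hO : IsOpen ((extChartAt I (i : M)).source ×ˢ (univ : Set ℝ)) :=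
        (isOpen_extChartAt_source (i : M)).prod isOpen_univ
      have hmem : (x, s) ∈ (extChartAt I (i : M)).source ×ˢ (univ : Set ℝ) := ⟨hsrc, mem_univ _⟩
      have hcomp : ContMDiffWithinAt (I.prod 𝓘(ℝ, ℝ)) 𝓘(ℝ, ℝ) ∞
          (Wc i ∘ fun z : M × ℝ ↦ (extChartAt I (i : M) z.1, z.2))
          ((extChartAt I (i : M)).source ×ˢ (univ : Set ℝ)) (x, s) :=
        (hWcs i).comp_contMDiffWithinAt (contMDiffOn_extChartAt_prod_id (i : M) univ _ hmem)
      have heq : ∀ z ∈ (extChartAt I (i : M)).source ×ˢ (univ : Set ℝ),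
          Wt i z.2 z.1 = (Wc i ∘ fun z : M × ℝ ↦ (extChartAt I (i : M) z.1, z.2)) z := by
        rintro ⟨x', s'⟩ ⟨hx', -⟩
        have hx'' : x' ∈ (chartAt H (i : M)).source := by rwa [extChartAt_source] at hx'
        simp [hWt, hx'']
      exact ((hcomp.congr (fun z hz ↦ heq z hz) (heq _ hmem)).contMDiffAt (hO.mem_nhds hmem))
    · obtain ⟨N, hN, hN0⟩ := hWt_zero i x (fun h ↦ hx (hρsrc i h))
      have hev : (fun p : M × ℝ ↦ Wt i p.2 p.1) =ᶠ[𝓝 (x, s)] fun _ ↦ 0 := by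
        have : N ×ˢ (univ : Set ℝ) ∈ 𝓝 (x, s) := prod_mem_nhds hN univ_mem
        filter_upwards [this] with p hp using hN0 p.1 hp.1 p.2
      exact contMDiffAt_const.congr_of_eventuallyEq hev
  have hWt_jet : ∀ i k x, iteratedDeriv k (fun s ↦ Wt i s x) 0 = ρ i x * a k x := by
    intro i k x
    by_cases hx : x ∈ (chartAt H (i : M)).source
    · have h1 : (fun s ↦ Wt i s x) =
          fun s ↦ ∑' k, cutoffMonomial k (ε i k) s * b i k (extChartAt I (i : M) x) := by
        funext s; simp [hWt, hx, hWc]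
      rw [h1, hWcjet i, hbchart i k x hx]
    · have h1 : (fun s ↦ Wt i s x) = fun _ ↦ (0 : ℝ) := by
        funext s; simp [hWt, hx]
      rw [h1, iteratedDeriv_const, image_eq_zero_of_notMem_tsupport (fun h ↦ hx (hρsrc i h))]
      simp
  -- the sum over the cover
  refine ⟨fun s x ↦ ∑ i, Wt i s x, ⋃ i, tsupport (ρ i), isCompact_iUnion fun i ↦ hρcpt i,
    contMDiff_finsetSum fun i _ ↦ hWt_smooth i, fun k x ↦ ?_, fun s x hx ↦ ?_⟩
  · have h1 : (fun s ↦ ∑ i, Wt i s x) = ∑ i, (fun s ↦ Wt i s x) := by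
      funext s; simp only [Finset.sum_apply]
    rw [h1, iteratedDeriv_sum (fun i _ ↦ ((contDiff_time_slice (hWt_smooth i) x).contDiffAt.of_le
      (by exact_mod_cast le_top)))]
    simp_rw [hWt_jet]
    rw [← Finset.sum_mul]
    by_cases hxK : x ∈ K
    · have hone : ∑ i, ρ i x = 1 := by
        rw [← finsum_eq_sum_of_fintype]
        exact ρ.sum_eq_one hxK
      rw [hone, one_mul]
    · rw [haK k x hxK, mul_zero]
  · refine Finset.sum_eq_zero fun i _ ↦ hWt_zero' i x ?_ s
    exact fun h ↦ hx (mem_iUnion.2 ⟨i, h⟩)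

end ManifoldBorel

/-! ### The flat corrector with compact support -/

section Corrector

variable {n : ℕ} {M : Type*} [TopologicalSpace M] [T2Space M] [SecondCountableTopology M]
  [ChartedSpace (EuclideanSpace ℝ (Fin n)) M] [IsManifold (𝓡 n) ∞ M]

/-- A smooth time cut-off `θ : ℝ → ℝ` with `θ = 1` on `(−∞, 1/2]` and `θ = 0` on `[1, ∞)`. [folklore] -/
theorem exists_timeCutoff : ∃ θ : ℝ → ℝ, ContDiff ℝ ∞ θ ∧ (∀ s ≤ (1 / 2 : ℝ), θ s = 1) ∧
    ∀ s, (1 : ℝ) ≤ s → θ s = 0 := by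
  refine ⟨fun s ↦ Real.smoothTransition (2 - 2 * s),
    Real.smoothTransition.contDiff.comp (contDiff_const.sub (contDiff_const.mul contDiff_id)),
    fun s hs ↦ Real.smoothTransition.one_of_one_le (by linarith), fun s hs ↦
    Real.smoothTransition.zero_of_nonpos (by linarith)⟩

omit [T2Space M] [SecondCountableTopology M] in
/-- **The jets of the formal solution are supported in the support of the datum**: for a static metric
`g` and `x ∉ tsupport w₀`, `heatJet (heatOp (fun _ ↦ g) Q) w₀ k x = 0` — in fact every Taylor polynomial
`heatTaylor … k s` vanishes on the open set `(tsupport w₀)ᶜ` (locality of `Δ_g`). [folklore] -/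
theorem heatTaylor_eq_zero_of_notMem_tsupport
    (g : PseudoRiemannianMetric (𝓡 n) ∞ (EuclideanSpace ℝ (Fin n)) (TangentSpace (𝓡 n) : M → Type _))
    (Q : ℝ → M → ℝ) (w₀ : M → ℝ) (k : ℕ) :
    ∀ s, ∀ x ∉ tsupport w₀, heatTaylor (heatOp (fun _ ↦ g) Q) w₀ k s x = 0 := by
  haveI := g.hasLeviCivita
  induction k with
  | zero =>
    intro s x hx
    exact image_eq_zero_of_notMem_tsupport hx
  | succ k IH =>
    intro s x hx
    rw [heatTaylor_succ, IH s x hx, zero_add]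
    have hL : ∀ r, heatOp (fun _ ↦ g) Q r (heatTaylor (heatOp (fun _ ↦ g) Q) w₀ k r) x = 0 := by
      intro r
      rw [heatOp_apply, IH r x hx, mul_zero, sub_zero, laplaceBeltrami_eq_dalembertian]
      refine g.dalembertian_eq_zero_of_eventuallyEq_zero ?_
      filter_upwards [(isClosed_tsupport w₀).isOpen_compl.mem_nhds hx] with y hy
      exact IH r y hy
    have h0 : (fun r ↦ heatOp (fun _ ↦ g) Q r (heatTaylor (heatOp (fun _ ↦ g) Q) w₀ k r) x) =
        fun _ ↦ (0 : ℝ) := funext hL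
    rw [h0, iteratedDeriv_const]
    simp

omit [T2Space M] [SecondCountableTopology M] in
/-- The jets vanish off the support of the datum. [folklore] -/
theorem heatJet_eq_zero_of_notMem_tsupport
    (g : PseudoRiemannianMetric (𝓡 n) ∞ (EuclideanSpace ℝ (Fin n)) (TangentSpace (𝓡 n) : M → Type _))
    (Q : ℝ → M → ℝ) (w₀ : M → ℝ) (k : ℕ) (x : M) (hx : x ∉ tsupport w₀) :
    heatJet (heatOp (fun _ ↦ g) Q) w₀ k x = 0 := by
  unfold heatJet
  have h0 : (fun s ↦ heatTaylor (heatOp (fun _ ↦ g) Q) w₀ k s x) = fun _ ↦ (0 : ℝ) :=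
    funext fun s ↦ heatTaylor_eq_zero_of_notMem_tsupport g Q w₀ k s x hx
  rw [h0, iteratedDeriv_const]
  simp

/-- **Helper `helper_flatCorrector_noncompact`** (line `collapsed-ends-usc`, v13; see the module docstring):
reduction of the Cauchy problem `∂ₛw = Δ_g w − Qw`, `w(0) = w₀ ∈ C_c^∞` on a (non-compact) manifold to a
problem with a smooth forcing supported in `K × [0, 1]`, `K` compact: `W`, `G` smooth on `M × ℝ`, `W(0) = w₀`,
`W = G = 0` off `K` and for `s ≥ 1`, `G = 0` for `s ≤ 0`, `G = −(∂ₛW − Δ_g W + QW)` for `s ≥ 0`.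
[cite: Treves1975, §41] -/
theorem helper_flatCorrector_noncompact : ∀ (n : ℕ) (M : Type*) [TopologicalSpace M] [T2Space M] [SecondCountableTopology M] [ChartedSpace (EuclideanSpace ℝ (Fin n)) M] [IsManifold (𝓡 n) ∞ M] (g : PseudoRiemannianMetric (𝓡 n) ∞ (EuclideanSpace ℝ (Fin n)) (TangentSpace (𝓡 n) : M → Type _)) (Q : ℝ → M → ℝ), ContMDiff ((𝓡 n).prod 𝓘(ℝ, ℝ)) 𝓘(ℝ, ℝ) ∞ (fun p : M × ℝ ↦ Q p.2 p.1) → ∀ (w₀ : M → ℝ), ContMDiff (𝓡 n) 𝓘(ℝ, ℝ) ∞ w₀ → HasCompactSupport w₀ → ∃ (W G : ℝ → M → ℝ) (K : Set M), IsCompact K ∧ ContMDiff ((𝓡 n).prod 𝓘(ℝ, ℝ)) 𝓘(ℝ, ℝ) ∞ (fun p : M × ℝ ↦ W p.2 p.1) ∧ ContMDiff ((𝓡 n).prod 𝓘(ℝ, ℝ)) 𝓘(ℝ, ℝ) ∞ (fun p : M × ℝ ↦ G p.2 p.1) ∧ W 0 = w₀ ∧ (∀ s x, x ∉ K → W s x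 = 0) ∧ (∀ s x, x ∉ K → G s x = 0) ∧ (∀ s, 1 ≤ s → ∀ x, W s x = 0 ∧ G s x = 0) ∧ (∀ s ≤ 0, ∀ x, G s x = 0) ∧ ∀ s, 0 ≤ s → ∀ x, G s x = -(deriv (fun r ↦ W r x) s - (g.laplaceBeltrami (W s) x - Q s x * W s x)) := by
  intro n M _ _ _ _ _ g Q hQ w₀ hw₀ hw₀c
  classical
  haveI : LocallyCompactSpace M := ChartedSpace.locallyCompactSpace (EuclideanSpace ℝ (Fin n)) M
  haveI := g.hasLeviCivita
  set h : ℝ → PseudoRiemannianMetric (𝓡 n) ∞ (EuclideanSpace ℝ (Fin n)) (TangentSpace (𝓡 n) : M → Type _) :=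
    fun _ ↦ g with hh'
  have hh : IsContMDiffFamilyOn ∞ h univ := isContMDiffFamilyOn_const g univ
  -- Borel's lemma on the compact support of the datum, with the jets of the formal solution
  obtain ⟨W₁, K, hKc, hW₁s, hW₁jet, hW₁K⟩ :=
    exists_contMDiff_forall_iteratedDeriv_eq_of_isCompact (I := 𝓡 n) hw₀c.isCompact
      (a := heatJet (heatOp h Q) w₀) (contMDiff_heatJet hh hQ hw₀)
      (fun k x hx ↦ heatJet_eq_zero_of_notMem_tsupport g Q w₀ k x hx)
  -- the time cut-off
  obtain ⟨θ, hθs, hθ1, hθ0⟩ := exists_timeCutoff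
  set W : ℝ → M → ℝ := fun s x ↦ θ s * W₁ s x with hWdef
  have hWs : ContMDiff ((𝓡 n).prod 𝓘(ℝ, ℝ)) 𝓘(ℝ, ℝ) ∞ (fun p : M × ℝ ↦ W p.2 p.1) :=
    ((contMDiff_iff_contDiff.2 hθs).comp contMDiff_snd).mul hW₁s
  have hWev : ∀ x, (fun s ↦ W s x) =ᶠ[𝓝 0] fun s ↦ W₁ s x := fun x ↦ by
    filter_upwards [Iio_mem_nhds (by norm_num : (0 : ℝ) < 1 / 2)] with s hs
    simp [hWdef, hθ1 s hs.le]
  have hWjet : ∀ (k : ℕ) (x : M), iteratedDeriv k (fun s ↦ W s x) 0 = heatJet (heatOp h Q) w₀ k x :=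
    fun k x ↦ by rw [(hWev x).iteratedDeriv_eq, hW₁jet k x]
  have hWK : ∀ s x, x ∉ K → W s x = 0 := fun s x hx ↦ by simp [hWdef, hW₁K s x hx]
  have hW1 : ∀ s, 1 ≤ s → ∀ x, W s x = 0 := fun s hs x ↦ by simp [hWdef, hθ0 s hs]
  -- the residual and its flatness
  set F : ℝ → M → ℝ := fun s x ↦ -(deriv (fun r ↦ W r x) s - heatOp h Q s (W s) x) with hF
  have hFs : ContMDiff ((𝓡 n).prod 𝓘(ℝ, ℝ)) 𝓘(ℝ, ℝ) ∞ (fun p : M × ℝ ↦ F p.2 p.1) := by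
    have h1 : ContMDiff ((𝓡 n).prod 𝓘(ℝ, ℝ)) 𝓘(ℝ, ℝ) ∞
        (fun p : M × ℝ ↦ deriv (fun r ↦ W r p.1) p.2) := by
      have := contMDiff_iteratedDeriv_time hWs 1
      simpa only [iteratedDeriv_one] using this
    exact (h1.sub (contMDiff_heatOp' hh hQ hWs)).neg
  have hFflat : ∀ (x : M) (i : ℕ), iteratedDeriv i (fun s ↦ F s x) 0 = 0 := by
    intro x i
    have h1 : (fun s ↦ F s x) = fun s ↦ -(deriv (fun r ↦ W r x) s - heatOp h Q s (W s) x) := rfl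
    rw [h1, iteratedDeriv_fun_neg, iteratedDeriv_residual_eq_zero hh hQ hw₀ hWs hWjet x i, neg_zero]
  -- the residual vanishes off `K` and for `s ≥ 1`
  have hFzero : ∀ s x, (∀ᶠ y in 𝓝 x, ∀ r, W r y = 0) → F s x = 0 := by
    intro s x hx
    have hx0 : ∀ r, W r x = 0 := fun r ↦ hx.self_of_nhds r
    have hd : deriv (fun r ↦ W r x) s = 0 := by
      have : (fun r ↦ W r x) = fun _ ↦ (0 : ℝ) := funext hx0
      rw [this, deriv_const]
    have hL : heatOp h Q s (W s) x = 0 := by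
      rw [heatOp_apply, hx0 s, mul_zero, sub_zero]
      show g.laplaceBeltrami (W s) x = 0
      rw [laplaceBeltrami_eq_dalembertian]
      exact g.dalembertian_eq_zero_of_eventuallyEq_zero (hx.mono fun y hy ↦ hy s)
    show -(deriv (fun r ↦ W r x) s - heatOp h Q s (W s) x) = 0
    rw [hd, hL]; simp
  have hFK : ∀ s x, x ∉ K → F s x = 0 := fun s x hx ↦ by
    refine hFzero s x ?_
    filter_upwards [hKc.isClosed.isOpen_compl.mem_nhds hx] with y hy r using hWK r y hy
  have hFtime : ∀ s x, (∀ᶠ r in 𝓝 s, ∀ y, W r y = 0) → F s x = 0 := by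
    intro s x hs
    have hs0 : ∀ y, W s y = 0 := hs.self_of_nhds
    have hd : deriv (fun r ↦ W r x) s = 0 := by
      rw [Filter.EventuallyEq.deriv_eq (hs.mono fun r hr ↦ hr x)]
      exact deriv_const s 0
    have hL : heatOp h Q s (W s) x = 0 := by
      have : W s = fun _ ↦ (0 : ℝ) := funext hs0
      rw [heatOp_apply, this]
      show g.laplaceBeltrami (fun _ : M ↦ (0 : ℝ)) x - Q s x * 0 = 0
      rw [mul_zero, sub_zero, laplaceBeltrami_eq_dalembertian]
      exact g.dalembertian_eq_zero_of_eventuallyEq_zero (Eventually.of_forall fun _ ↦ rfl)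
    show -(deriv (fun r ↦ W r x) s - heatOp h Q s (W s) x) = 0
    rw [hd, hL]; simp
  have hF1 : ∀ s, 1 < s → ∀ x, F s x = 0 := fun s hs x ↦ by
    refine hFtime s x ?_
    filter_upwards [Ioi_mem_nhds hs] with r hr y using hW1 r hr.le y
  -- the forcing `G = 1_{s > 0} F`
  refine ⟨W, fun s x ↦ if 0 < s then F s x else 0, K, hKc, hWs, contMDiff_timeCutoff_manifold hFs hFflat,
    ?_, hWK, ?_, ?_, ?_, ?_⟩
  · funext x
    have := hWjet 0 x
    rw [iteratedDeriv_zero, heatJet_zero] at this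
    exact this
  · intro s x hx
    by_cases hs : 0 < s
    · simp [hs, hFK s x hx]
    · simp [hs]
  · intro s hs x
    refine ⟨hW1 s hs x, ?_⟩
    rcases hs.lt_or_eq with hs' | rfl
    · simp [hF1 s hs' x]
    · -- at `s = 1`: `F 1 x = 0` by continuity from the right
      have hcont : Continuous fun r ↦ F r x :=
        (contDiff_time_slice hFs x).continuous
      have hlim : Tendsto (fun r ↦ F r x) (𝓝[>] 1) (𝓝 (F 1 x)) := hcont.continuousAt.continuousWithinAt
      have hev : (fun r ↦ F r x) =ᶠ[𝓝[>] 1] fun _ ↦ 0 := by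
        filter_upwards [self_mem_nhdsWithin] with r hr using hF1 r hr x
      have h0 : F 1 x = 0 := tendsto_nhds_unique hlim (tendsto_const_nhds.congr' hev.symm)
      simp [h0]
  · intro s hs x
    simp [not_lt.2 hs]
  · intro s hs x
    rcases hs.lt_or_eq with hs' | rfl
    · simp [hs', hF, hh']
    · have := hFflat x 0
      rw [iteratedDeriv_zero] at this
      simp only [hF, heatOp_apply] at this
      simp only [lt_irrefl, if_false]
      show (0 : ℝ) = -(deriv (fun r ↦ W r x) 0 - (g.laplaceBeltrami (W 0) x - Q 0 x * W 0 x))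
      linarith

end Corrector

end Summit.SmoothPoincare4.SmoothPoincare4.Theorems.NoncompactShrinkerGapHeat

end
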